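import Summits.CriticalPhenomena.PercolationContinuityZ3.Theorems.PercNearOneGluingAdditiveGluingThreeRelaysAssembly
import Summits.CriticalPhenomena.PercolationContinuityZ3.Theorems.PercNearOneGluingAdditiveGluingThreeRelaysKPatterns
import HarnessLib

/-!
# Crux `PercNearOneGluing.AdditiveGluing` (stmt-CriticalPhenomena-4576): the three-relay case from the (K)-INEQUALITY
# `(φ₁₂ − φ₁ − φ₂)·(m₃ − m₁₂) ≤ μ(o ↮ A, a₃ ↮ b)` (seat (d) exchange-certificate form, gen 3)

Support file (`--supports stmt-CriticalPhenomena-4576`); no definitions, no named facts, no sorries.  CONDITIONAL results (the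
hypothesis `hK` is spelled out).

Setting of Kozma–Nitzan's Theorem 2 (three relays `a₁, a₂, a₃`, observer `o`, target `b`, `a₃` worst): `φ_O = μ(o ↔ O | O ↮ A∖O)`
the attachments, `m_T = μ(C(b) ∩ A = T)`, `ε := φ₁₂ − φ₁ − φ₂ ≥ 0` the defect in KN's Lemma 2, `Δ := m₃ − m₁₂` (the BAD region is
`Δ > 0`), `ROOM := μ(o ↮ A, a₃ ↮ b)`.  Deep seat r2's certificate (T1) (`additiveGluing_threeRelays_of_regionCert`, hypothesis of
`knThm2_region_eform`) reads, after division by `P₁P₂P₁₂`,  `ROOM + φ₁(τ₁ − τ₃) + φ₂(τ₂ − τ₃) − ε·Δ ≥ 0`  (the pattern identity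
`m_j − m_{k3} = Δ + (τ_j − τ₃)`, `kred_tau_sub₁/₂` of `…ThreeRelaysKPatterns`).  Hence the three-relay case follows from the single inequality
  (K)   `ε · Δ ≤ ROOM`,   i.e.  `(U₁₂P₁P₂ − U₁P₂P₁₂ − U₂P₁P₁₂)(m₃ − m₁₂) ≤ P₁P₂P₁₂ · μ(o ↮ A, a₃ ↮ b)`  (division-free),
for the instances of the nontrivial bad region (`regionCert_of_K`).  This seat's exact census (n ≤ 9; 42 000 instances with `a₃ = argmin τ`,
kit j039764): (K) has NO violation and holds with a wide margin — `ε·Δ ≤ ROOM / 9` throughout, the extremal configurations being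
star-like hubs in the TRIVIAL region; on the full-tie locus (official stub) (T1) reduces to (K) exactly.  Exact structure found on the way
(evidence EXCHCERT-g3.md): `μ(M)·ε = μ(R₁₂)[μ(o↔A₁₂ | R₁₂) − φ₁₂] + μ(R₂₃)[φ₁ − μ(o↔a₁ | R₂₃)] + μ(R₁₃)[φ₂ − μ(o↔a₂ | R₁₃)]`
(`M` = all relays separated, `R_{jk}` = exactly `a_j ~ a_k` glued), each bracket a BHK monotonicity slack, and the o-free inequality
`μ(R₁₂)·Δ ≤ μ(M ∩ a₃ ↮ b)` (0 violations).
* `regionCert_of_K`: (K) on the region ⟹ (T1) on the region;  * `additiveGluing_of_erase_card_le_three_of_K`,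
  `threeRelays_eform_of_K`, `threeRelaysFullTieAllBad_of_K` (the registered stub of the official skeleton): corollaries via r2's assembly.
[cite: KozmaNitzan2024, Lemma 2 (p. 6), Theorem 2 (§3.1, pp. 8–9, eq. (7)), Conjecture 1 (p. 3)]
-/

namespace Summit.CriticalPhenomena.PercolationContinuityZ3.Theorems

open MeasureTheory Set Literature.Probability.LatticeModels Literature.Probability.Percolation
open scoped Classical

/-- **(K) on the nontrivial bad region implies the certificate (T1) there.**  Instance by instance:
`(T1)·1 = [P₁P₂P₁₂·ROOM − (U₁₂P₁P₂ − U₁P₂P₁₂ − U₂P₁P₁₂)Δ] + U₁P₂P₁₂(τ₁ − τ₃) + U₂P₁P₁₂(τ₂ − τ₃)` and the last two products are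
nonnegative because `a₃` is worst. [cite: KozmaNitzan2024, Theorem 2 (§3.1, pp. 8–9)] -/
theorem regionCert_of_K
    (hK : ∀ (n : ℕ) (w : Sym2 (Fin n) → unitInterval) (o b a₁ a₂ a₃ : Fin n),
      a₁ ≠ a₂ → a₁ ≠ a₃ → a₂ ≠ a₃ →
      (prodBernoulli w).real (openConn a₃ b) ≤ (prodBernoulli w).real (openConn a₁ b) →
      (prodBernoulli w).real (openConn a₃ b) ≤ (prodBernoulli w).real (openConn a₂ b) →
      (prodBernoulli w).real (openConn o b) < (prodBernoulli w).real (openConn a₃ b) →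
      (prodBernoulli w).real ((openConn a₁ a₃)ᶜ ∩ (openConn a₂ a₃)ᶜ ∩ (openConn a₁ b ∩ openConn a₂ b)) < (prodBernoulli w).real ((openConn a₁ a₃)ᶜ ∩ (openConn a₂ a₃)ᶜ ∩ openConn a₃ b) →
      ((prodBernoulli w).real ((openConn a₁ a₃)ᶜ ∩ (openConn a₂ a₃)ᶜ ∩ (openConn a₁ o ∪ openConn a₂ o)) * (prodBernoulli w).real ((openConn a₁ a₂)ᶜ ∩ (openConn a₁ a₃)ᶜ : Set (BondConfig (Fin n))) * (prodBernoulli w).real ((openConn a₂ a₁)ᶜ ∩ (openConn a₂ a₃)ᶜ : Set (BondConfig (Fin n)))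
          - (prodBernoulli w).real ((openConn a₁ a₂)ᶜ ∩ (openConn a₁ a₃)ᶜ ∩ openConn a₁ o) * (prodBernoulli w).real ((openConn a₂ a₁)ᶜ ∩ (openConn a₂ a₃)ᶜ : Set (BondConfig (Fin n))) * (prodBernoulli w).real ((openConn a₁ a₃)ᶜ ∩ (openConn a₂ a₃)ᶜ : Set (BondConfig (Fin n)))
          - (prodBernoulli w).real ((openConn a₂ a₁)ᶜ ∩ (openConn a₂ a₃)ᶜ ∩ openConn a₂ o) * (prodBernoulli w).real ((openConn a₁ a₂)ᶜ ∩ (openConn a₁ a₃)ᶜ : Set (BondConfig (Fin n))) * (prodBernoulli w).real ((openConn a₁ a₃)ᶜ ∩ (openConn a₂ a₃)ᶜ : Set (BondConfig (Fin n))))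
        * ((prodBernoulli w).real ((openConn a₁ a₃)ᶜ ∩ (openConn a₂ a₃)ᶜ ∩ openConn a₃ b) - (prodBernoulli w).real ((openConn a₁ a₃)ᶜ ∩ (openConn a₂ a₃)ᶜ ∩ (openConn a₁ b ∩ openConn a₂ b)))
      ≤ (prodBernoulli w).real ((openConn a₁ a₂)ᶜ ∩ (openConn a₁ a₃)ᶜ : Set (BondConfig (Fin n))) * (prodBernoulli w).real ((openConn a₂ a₁)ᶜ ∩ (openConn a₂ a₃)ᶜ : Set (BondConfig (Fin n))) * (prodBernoulli w).real ((openConn a₁ a₃)ᶜ ∩ (openConn a₂ a₃)ᶜ : Set (BondConfig (Fin n)))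
        * (prodBernoulli w).real ((openConn o a₁ ∪ openConn o a₂ ∪ openConn o a₃)ᶜ ∩ (openConn a₃ b)ᶜ : Set (BondConfig (Fin n)))) :
    ∀ (n : ℕ) (w : Sym2 (Fin n) → unitInterval) (o b a₁ a₂ a₃ : Fin n),
      a₁ ≠ a₂ → a₁ ≠ a₃ → a₂ ≠ a₃ →
      (prodBernoulli w).real (openConn a₃ b) ≤ (prodBernoulli w).real (openConn a₁ b) →
      (prodBernoulli w).real (openConn a₃ b) ≤ (prodBernoulli w).real (openConn a₂ b) →
      (prodBernoulli w).real (openConn o b) < (prodBernoulli w).real (openConn a₃ b) →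
      (prodBernoulli w).real ((openConn a₁ a₃)ᶜ ∩ (openConn a₂ a₃)ᶜ ∩ (openConn a₁ b ∩ openConn a₂ b)) <
        (prodBernoulli w).real ((openConn a₁ a₃)ᶜ ∩ (openConn a₂ a₃)ᶜ ∩ openConn a₃ b) →
      0 ≤
      (prodBernoulli w).real ((openConn a₁ a₃)ᶜ ∩ (openConn a₂ a₃)ᶜ ∩ (openConn a₁ o ∪ openConn a₂ o)) *
            (prodBernoulli w).real ((openConn a₁ a₂)ᶜ ∩ (openConn a₁ a₃)ᶜ : Set (BondConfig (Fin n))) *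
            (prodBernoulli w).real ((openConn a₂ a₁)ᶜ ∩ (openConn a₂ a₃)ᶜ : Set (BondConfig (Fin n))) *
          ((prodBernoulli w).real ((openConn a₁ a₃)ᶜ ∩ (openConn a₂ a₃)ᶜ ∩ (openConn a₁ b ∩ openConn a₂ b)) -
            (prodBernoulli w).real ((openConn a₁ a₃)ᶜ ∩ (openConn a₂ a₃)ᶜ ∩ openConn a₃ b)) +
        (prodBernoulli w).real ((openConn a₁ a₂)ᶜ ∩ (openConn a₁ a₃)ᶜ ∩ openConn a₁ o) *
            (prodBernoulli w).real ((openConn a₁ a₃)ᶜ ∩ (openConn a₂ a₃)ᶜ : Set (BondConfig (Fin n))) *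
            (prodBernoulli w).real ((openConn a₂ a₁)ᶜ ∩ (openConn a₂ a₃)ᶜ : Set (BondConfig (Fin n))) *
          ((prodBernoulli w).real ((openConn a₁ a₂)ᶜ ∩ (openConn a₁ a₃)ᶜ ∩ openConn a₁ b) -
            (prodBernoulli w).real ((openConn a₁ a₂)ᶜ ∩ (openConn a₁ a₃)ᶜ ∩ (openConn a₂ b ∩ openConn a₃ b))) +
        (prodBernoulli w).real ((openConn a₂ a₁)ᶜ ∩ (openConn a₂ a₃)ᶜ ∩ openConn a₂ o) *
            (prodBernoulli w).real ((openConn a₁ a₃)ᶜ ∩ (openConn a₂ a₃)ᶜ : Set (BondConfig (Fin n))) *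
            (prodBernoulli w).real ((openConn a₁ a₂)ᶜ ∩ (openConn a₁ a₃)ᶜ : Set (BondConfig (Fin n))) *
          ((prodBernoulli w).real ((openConn a₂ a₁)ᶜ ∩ (openConn a₂ a₃)ᶜ ∩ openConn a₂ b) -
            (prodBernoulli w).real ((openConn a₂ a₁)ᶜ ∩ (openConn a₂ a₃)ᶜ ∩ (openConn a₁ b ∩ openConn a₃ b))) +
        (prodBernoulli w).real ((openConn a₁ a₂)ᶜ ∩ (openConn a₁ a₃)ᶜ : Set (BondConfig (Fin n))) *
            (prodBernoulli w).real ((openConn a₂ a₁)ᶜ ∩ (openConn a₂ a₃)ᶜ : Set (BondConfig (Fin n))) *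
            (prodBernoulli w).real ((openConn a₁ a₃)ᶜ ∩ (openConn a₂ a₃)ᶜ : Set (BondConfig (Fin n))) *
          (prodBernoulli w).real
            ((openConn o a₁ ∪ openConn o a₂ ∪ openConn o a₃)ᶜ ∩ (openConn a₃ b)ᶜ : Set (BondConfig (Fin n))) := by
  intro n w o b a₁ a₂ a₃ h12 h13 h23 hτ31 hτ32 hob hbad
  have hKi := hK n w o b a₁ a₂ a₃ h12 h13 h23 hτ31 hτ32 hob hbad
  have id₁ := kred_tau_sub₁ w b a₁ a₂ a₃
  have id₂ := kred_tau_sub₂ w b a₁ a₂ a₃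
  have hU1 : 0 ≤ (prodBernoulli w).real ((openConn a₁ a₂)ᶜ ∩ (openConn a₁ a₃)ᶜ ∩ openConn a₁ o) := measureReal_nonneg
  have hU2 : 0 ≤ (prodBernoulli w).real ((openConn a₂ a₁)ᶜ ∩ (openConn a₂ a₃)ᶜ ∩ openConn a₂ o) := measureReal_nonneg
  have hP12 : 0 ≤ (prodBernoulli w).real ((openConn a₁ a₃)ᶜ ∩ (openConn a₂ a₃)ᶜ : Set (BondConfig (Fin n))) := measureReal_nonneg
  have hP1 : 0 ≤ (prodBernoulli w).real ((openConn a₁ a₂)ᶜ ∩ (openConn a₁ a₃)ᶜ : Set (BondConfig (Fin n))) := measureReal_nonneg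
  have hP2 : 0 ≤ (prodBernoulli w).real ((openConn a₂ a₁)ᶜ ∩ (openConn a₂ a₃)ᶜ : Set (BondConfig (Fin n))) := measureReal_nonneg
  have g₁ : 0 ≤ (prodBernoulli w).real ((openConn a₁ a₂)ᶜ ∩ (openConn a₁ a₃)ᶜ ∩ openConn a₁ o) * (prodBernoulli w).real ((openConn a₁ a₃)ᶜ ∩ (openConn a₂ a₃)ᶜ : Set (BondConfig (Fin n))) * (prodBernoulli w).real ((openConn a₂ a₁)ᶜ ∩ (openConn a₂ a₃)ᶜ : Set (BondConfig (Fin n))) *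
      ((prodBernoulli w).real (openConn a₁ b) - (prodBernoulli w).real (openConn a₃ b)) :=
    mul_nonneg (mul_nonneg (mul_nonneg hU1 hP12) hP2) (sub_nonneg.2 hτ31)
  have g₂ : 0 ≤ (prodBernoulli w).real ((openConn a₂ a₁)ᶜ ∩ (openConn a₂ a₃)ᶜ ∩ openConn a₂ o) * (prodBernoulli w).real ((openConn a₁ a₃)ᶜ ∩ (openConn a₂ a₃)ᶜ : Set (BondConfig (Fin n))) * (prodBernoulli w).real ((openConn a₁ a₂)ᶜ ∩ (openConn a₁ a₃)ᶜ : Set (BondConfig (Fin n))) *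
      ((prodBernoulli w).real (openConn a₂ b) - (prodBernoulli w).real (openConn a₃ b)) :=
    mul_nonneg (mul_nonneg (mul_nonneg hU2 hP12) hP1) (sub_nonneg.2 hτ32)
  rw [id₁] at g₁
  rw [id₂] at g₂
  nlinarith [hKi, g₁, g₂]

/-- **`AdditiveGluing` for every relay set with at most three relays besides the target, from (K)** (via deep seat r2's assembly
`additiveGluing_of_erase_card_le_three_of_regionCert`). [cite: KozmaNitzan2024, Conjecture 1 (p. 3), Theorem 2 (§3.1)] -/
theorem additiveGluing_of_erase_card_le_three_of_K
    (hK : ∀ (n : ℕ) (w : Sym2 (Fin n) → unitInterval) (o b a₁ a₂ a₃ : Fin n),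
      a₁ ≠ a₂ → a₁ ≠ a₃ → a₂ ≠ a₃ →
      (prodBernoulli w).real (openConn a₃ b) ≤ (prodBernoulli w).real (openConn a₁ b) →
      (prodBernoulli w).real (openConn a₃ b) ≤ (prodBernoulli w).real (openConn a₂ b) →
      (prodBernoulli w).real (openConn o b) < (prodBernoulli w).real (openConn a₃ b) →
      (prodBernoulli w).real ((openConn a₁ a₃)ᶜ ∩ (openConn a₂ a₃)ᶜ ∩ (openConn a₁ b ∩ openConn a₂ b)) < (prodBernoulli w).real ((openConn a₁ a₃)ᶜ ∩ (openConn a₂ a₃)ᶜ ∩ openConn a₃ b) →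
      ((prodBernoulli w).real ((openConn a₁ a₃)ᶜ ∩ (openConn a₂ a₃)ᶜ ∩ (openConn a₁ o ∪ openConn a₂ o)) * (prodBernoulli w).real ((openConn a₁ a₂)ᶜ ∩ (openConn a₁ a₃)ᶜ : Set (BondConfig (Fin n))) * (prodBernoulli w).real ((openConn a₂ a₁)ᶜ ∩ (openConn a₂ a₃)ᶜ : Set (BondConfig (Fin n)))
          - (prodBernoulli w).real ((openConn a₁ a₂)ᶜ ∩ (openConn a₁ a₃)ᶜ ∩ openConn a₁ o) * (prodBernoulli w).real ((openConn a₂ a₁)ᶜ ∩ (openConn a₂ a₃)ᶜ : Set (BondConfig (Fin n))) * (prodBernoulli w).real ((openConn a₁ a₃)ᶜ ∩ (openConn a₂ a₃)ᶜ : Set (BondConfig (Fin n)))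
          - (prodBernoulli w).real ((openConn a₂ a₁)ᶜ ∩ (openConn a₂ a₃)ᶜ ∩ openConn a₂ o) * (prodBernoulli w).real ((openConn a₁ a₂)ᶜ ∩ (openConn a₁ a₃)ᶜ : Set (BondConfig (Fin n))) * (prodBernoulli w).real ((openConn a₁ a₃)ᶜ ∩ (openConn a₂ a₃)ᶜ : Set (BondConfig (Fin n))))
        * ((prodBernoulli w).real ((openConn a₁ a₃)ᶜ ∩ (openConn a₂ a₃)ᶜ ∩ openConn a₃ b) - (prodBernoulli w).real ((openConn a₁ a₃)ᶜ ∩ (openConn a₂ a₃)ᶜ ∩ (openConn a₁ b ∩ openConn a₂ b)))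
      ≤ (prodBernoulli w).real ((openConn a₁ a₂)ᶜ ∩ (openConn a₁ a₃)ᶜ : Set (BondConfig (Fin n))) * (prodBernoulli w).real ((openConn a₂ a₁)ᶜ ∩ (openConn a₂ a₃)ᶜ : Set (BondConfig (Fin n))) * (prodBernoulli w).real ((openConn a₁ a₃)ᶜ ∩ (openConn a₂ a₃)ᶜ : Set (BondConfig (Fin n)))
        * (prodBernoulli w).real ((openConn o a₁ ∪ openConn o a₂ ∪ openConn o a₃)ᶜ ∩ (openConn a₃ b)ᶜ : Set (BondConfig (Fin n)))) :
    ∀ (n : ℕ) (w : Sym2 (Fin n) → unitInterval) (A : Finset (Fin n)) (o b : Fin n) (t : ℝ),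
      (A.erase b).card ≤ 3 → 0 ≤ t →
      (∀ a ∈ A, 1 - t ≤ (prodBernoulli w).real (openConn a b)) →
      (prodBernoulli w).real (⋃ a ∈ A, openConn o a) - t ≤ (prodBernoulli w).real (openConn o b) :=
  additiveGluing_of_erase_card_le_three_of_regionCert (regionCert_of_K hK)

/-- **The three-relay E-form for any three distinct relays, from (K).** [cite: KozmaNitzan2024, Theorem 2 (§3.1, pp. 8–9)] -/
theorem threeRelays_eform_of_K
    (hK : ∀ (n : ℕ) (w : Sym2 (Fin n) → unitInterval) (o b a₁ a₂ a₃ : Fin n),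
      a₁ ≠ a₂ → a₁ ≠ a₃ → a₂ ≠ a₃ →
      (prodBernoulli w).real (openConn a₃ b) ≤ (prodBernoulli w).real (openConn a₁ b) →
      (prodBernoulli w).real (openConn a₃ b) ≤ (prodBernoulli w).real (openConn a₂ b) →
      (prodBernoulli w).real (openConn o b) < (prodBernoulli w).real (openConn a₃ b) →
      (prodBernoulli w).real ((openConn a₁ a₃)ᶜ ∩ (openConn a₂ a₃)ᶜ ∩ (openConn a₁ b ∩ openConn a₂ b)) < (prodBernoulli w).real ((openConn a₁ a₃)ᶜ ∩ (openConn a₂ a₃)ᶜ ∩ openConn a₃ b) →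
      ((prodBernoulli w).real ((openConn a₁ a₃)ᶜ ∩ (openConn a₂ a₃)ᶜ ∩ (openConn a₁ o ∪ openConn a₂ o)) * (prodBernoulli w).real ((openConn a₁ a₂)ᶜ ∩ (openConn a₁ a₃)ᶜ : Set (BondConfig (Fin n))) * (prodBernoulli w).real ((openConn a₂ a₁)ᶜ ∩ (openConn a₂ a₃)ᶜ : Set (BondConfig (Fin n)))
          - (prodBernoulli w).real ((openConn a₁ a₂)ᶜ ∩ (openConn a₁ a₃)ᶜ ∩ openConn a₁ o) * (prodBernoulli w).real ((openConn a₂ a₁)ᶜ ∩ (openConn a₂ a₃)ᶜ : Set (BondConfig (Fin n))) * (prodBernoulli w).real ((openConn a₁ a₃)ᶜ ∩ (openConn a₂ a₃)ᶜ : Set (BondConfig (Fin n)))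
          - (prodBernoulli w).real ((openConn a₂ a₁)ᶜ ∩ (openConn a₂ a₃)ᶜ ∩ openConn a₂ o) * (prodBernoulli w).real ((openConn a₁ a₂)ᶜ ∩ (openConn a₁ a₃)ᶜ : Set (BondConfig (Fin n))) * (prodBernoulli w).real ((openConn a₁ a₃)ᶜ ∩ (openConn a₂ a₃)ᶜ : Set (BondConfig (Fin n))))
        * ((prodBernoulli w).real ((openConn a₁ a₃)ᶜ ∩ (openConn a₂ a₃)ᶜ ∩ openConn a₃ b) - (prodBernoulli w).real ((openConn a₁ a₃)ᶜ ∩ (openConn a₂ a₃)ᶜ ∩ (openConn a₁ b ∩ openConn a₂ b)))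
      ≤ (prodBernoulli w).real ((openConn a₁ a₂)ᶜ ∩ (openConn a₁ a₃)ᶜ : Set (BondConfig (Fin n))) * (prodBernoulli w).real ((openConn a₂ a₁)ᶜ ∩ (openConn a₂ a₃)ᶜ : Set (BondConfig (Fin n))) * (prodBernoulli w).real ((openConn a₁ a₃)ᶜ ∩ (openConn a₂ a₃)ᶜ : Set (BondConfig (Fin n)))
        * (prodBernoulli w).real ((openConn o a₁ ∪ openConn o a₂ ∪ openConn o a₃)ᶜ ∩ (openConn a₃ b)ᶜ : Set (BondConfig (Fin n)))) :
    ∀ (n : ℕ) (w : Sym2 (Fin n) → unitInterval) (o b x y z : Fin n) (t : ℝ),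
      x ≠ y → x ≠ z → y ≠ z →
      1 - t ≤ (prodBernoulli w).real (openConn x b) →
      1 - t ≤ (prodBernoulli w).real (openConn y b) →
      1 - t ≤ (prodBernoulli w).real (openConn z b) →
      (prodBernoulli w).real ((openConn o x ∪ openConn o y ∪ openConn o z) \ openConn o b) ≤ t :=
  threeRelays_eform_of_regionCert (regionCert_of_K hK)

/-- **The registered stub `stub_threeRelaysFullTieAllBad_pl` of the official skeleton, from (K)** (its tie / all-bad / positivity
hypotheses are not needed). [cite: KozmaNitzan2024, Theorem 2 (§3.1, pp. 8–9)] -/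
theorem threeRelaysFullTieAllBad_of_K
    (hK : ∀ (n : ℕ) (w : Sym2 (Fin n) → unitInterval) (o b a₁ a₂ a₃ : Fin n),
      a₁ ≠ a₂ → a₁ ≠ a₃ → a₂ ≠ a₃ →
      (prodBernoulli w).real (openConn a₃ b) ≤ (prodBernoulli w).real (openConn a₁ b) →
      (prodBernoulli w).real (openConn a₃ b) ≤ (prodBernoulli w).real (openConn a₂ b) →
      (prodBernoulli w).real (openConn o b) < (prodBernoulli w).real (openConn a₃ b) →
      (prodBernoulli w).real ((openConn a₁ a₃)ᶜ ∩ (openConn a₂ a₃)ᶜ ∩ (openConn a₁ b ∩ openConn a₂ b)) < (prodBernoulli w).real ((openConn a₁ a₃)ᶜ ∩ (openConn a₂ a₃)ᶜ ∩ openConn a₃ b) →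
      ((prodBernoulli w).real ((openConn a₁ a₃)ᶜ ∩ (openConn a₂ a₃)ᶜ ∩ (openConn a₁ o ∪ openConn a₂ o)) * (prodBernoulli w).real ((openConn a₁ a₂)ᶜ ∩ (openConn a₁ a₃)ᶜ : Set (BondConfig (Fin n))) * (prodBernoulli w).real ((openConn a₂ a₁)ᶜ ∩ (openConn a₂ a₃)ᶜ : Set (BondConfig (Fin n)))
          - (prodBernoulli w).real ((openConn a₁ a₂)ᶜ ∩ (openConn a₁ a₃)ᶜ ∩ openConn a₁ o) * (prodBernoulli w).real ((openConn a₂ a₁)ᶜ ∩ (openConn a₂ a₃)ᶜ : Set (BondConfig (Fin n))) * (prodBernoulli w).real ((openConn a₁ a₃)ᶜ ∩ (openConn a₂ a₃)ᶜ : Set (BondConfig (Fin n)))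
          - (prodBernoulli w).real ((openConn a₂ a₁)ᶜ ∩ (openConn a₂ a₃)ᶜ ∩ openConn a₂ o) * (prodBernoulli w).real ((openConn a₁ a₂)ᶜ ∩ (openConn a₁ a₃)ᶜ : Set (BondConfig (Fin n))) * (prodBernoulli w).real ((openConn a₁ a₃)ᶜ ∩ (openConn a₂ a₃)ᶜ : Set (BondConfig (Fin n))))
        * ((prodBernoulli w).real ((openConn a₁ a₃)ᶜ ∩ (openConn a₂ a₃)ᶜ ∩ openConn a₃ b) - (prodBernoulli w).real ((openConn a₁ a₃)ᶜ ∩ (openConn a₂ a₃)ᶜ ∩ (openConn a₁ b ∩ openConn a₂ b)))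
      ≤ (prodBernoulli w).real ((openConn a₁ a₂)ᶜ ∩ (openConn a₁ a₃)ᶜ : Set (BondConfig (Fin n))) * (prodBernoulli w).real ((openConn a₂ a₁)ᶜ ∩ (openConn a₂ a₃)ᶜ : Set (BondConfig (Fin n))) * (prodBernoulli w).real ((openConn a₁ a₃)ᶜ ∩ (openConn a₂ a₃)ᶜ : Set (BondConfig (Fin n)))
        * (prodBernoulli w).real ((openConn o a₁ ∪ openConn o a₂ ∪ openConn o a₃)ᶜ ∩ (openConn a₃ b)ᶜ : Set (BondConfig (Fin n)))) :
    ∀ (n : ℕ) (w : Sym2 (Fin n) → unitInterval) (o b a₁ a₂ a₃ : Fin n) (t : ℝ), a₁ ≠ a₂ → a₁ ≠ a₃ → a₂ ≠ a₃ → 1 - t ≤ (prodBernoulli w).real (openConn a₃ b) → (prodBernoulli w).real (openConn a₃ b) ≤ (prodBernoulli w).real (openConn a₁ b) → (prodBernoulli w).real (openConn a₃ b) ≤ (prodBernoulli w).real (openConn a₂ b) → (prodBernoulli w).real (openConn a₁ b) ≤ (prodBernoulli w).real (openConn a₃ b) → (prodBernoulli w).real (openConn a₂ b) ≤ (prodBernoulli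 w).real (openConn a₃ b) → 0 < (prodBernoulli w).real ((openConn a₁ a₂)ᶜ ∩ (openConn a₁ a₃)ᶜ : Set (BondConfig (Fin n))) → 0 < (prodBernoulli w).real ((openConn a₂ a₁)ᶜ ∩ (openConn a₂ a₃)ᶜ : Set (BondConfig (Fin n))) → 0 < (prodBernoulli w).real ((openConn a₁ a₃)ᶜ ∩ (openConn a₂ a₃)ᶜ : Set (BondConfig (Fin n))) → (prodBernoulli w).real (openConn b a₂ ∩ openConn b a₃ ∩ (openConn b a₁)ᶜ) < (prodBernoulli w).real (openConn b a₁ ∩ (openConn b a₂)ᶜ ∩ (openConn b a₃)ᶜ) → (prodBernoulli w).real (openConn b a₁ ∩ openConn b a₃ ∩ (openConn b a₂)ᶜ) < (prodBernoulli w).real (openConn b a₂ ∩ (openConn b a₁)ᶜ ∩ (openConn b a₃)ᶜ) → (prodBernoulli w).real (openConn b a₁ ∩ openConn b a₂ ∩ (openConn b a₃)ᶜ) < (prodBernoulli w).real (openConn b a₃ ∩ (openConn b a₁)ᶜ ∩ (openConn b a₂)ᶜ) → (prodBernoulli w).real ((openConn o a₁ ∪ openConn o a₂ ∪ openConn o a₃)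 \ openConn o b) ≤ t := by
  intro n w o b a₁ a₂ a₃ t h12 h13 h23 hτ3 hτ31 hτ32 _ _ _ _ _ _ _ _
  exact additiveGluing_threeRelays_of_regionCert (regionCert_of_K hK) n w o b a₁ a₂ a₃ t h12 h13 h23 hτ3 hτ31 hτ32

end Summit.CriticalPhenomena.PercolationContinuityZ3.Theorems
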